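import Summits.AtomisticToContinuum.HydrodynamicLimit.Theorems.InformationPercolationEngineChaosClosesEulerReductionFrameE
import Summits.AtomisticToContinuum.HydrodynamicLimit.Theorems.InformationPercolationEngineChaosClosesEulerKineticReductionBudget
import Summits.AtomisticToContinuum.HydrodynamicLimit.Theorems.InformationPercolationEngineChaosClosesEulerKineticReductionData
import Summits.AtomisticToContinuum.HydrodynamicLimit.Theses.InformationPercolationEngine
import Summits.AtomisticToContinuum.HydrodynamicLimit.Theses.TwoClocks
import Summits.AtomisticToContinuum.HydrodynamicLimit.Theses.LimitCollisionMeasure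
import HarnessLib

/-!
# STUB `stub_kineticReduction` of the line `Sketch` (crux `InformationPercolationEngine.ChaosClosesEuler`,
# stmt-AtomisticToContinuum-15141): THE KINETIC REDUCTION — final assembly

WHAT. The registered stub `stub_kineticReduction` (skeleton v8 of `Cruxes/ChaosClosesEuler/Lines/Sketch.lean`): the
exact `C¹` mass balance, Bogolyubov's exact weak equation, the `t = 0` layer, weak stress isotropy in band, the
collisional pressure value in band, the uniform integrability of the quadratic collision mark, `CollisionRate`
(stmt-13481), the clamped local second law `LimitCollisionMeasure.LocalSecondLaw` (stmt-13352), `DensityCap`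
(stmt-13082) and the deterministic BF18 shell `BF18ShellHS` (v8 text) imply `MollifiedCloseTimeAveraged`: the
time-averaged `L¹(dx)` closeness in probability of the three cone-mollified empirical fields to the classical
hard-sphere Euler solution over every window `[t, t + Δ] ⊆ [0, T)`, "`N → ∞` then `r → 0`".

PROOF (the order of choices; everything else is the landed pyramid `…ChaosClosesEulerReduction*`). The band `η₀` of
the conclusion and the cut-off levels are read off the band edges of the inputs and of the `σ`-uniform extension of the
hard-sphere law (`exists_hsEos_band_extension_uniform_le`, band edge below the edge of the clamped second law and half
the analyticity radius of `HsEosLowDensity_holds`; `exists_levels`); `σ₀` is the least threshold of the seven inputs.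
Given `σ`, the solution, the guard, the flow family, the tie, `t`, `Δ`, `η`, `δ`: the shell at horizon `t + Δ` gives
clamp levels, then (tolerance `η/2`) a maximal short window `Δ₀`; the window `Δ` is tiled into `m + 1` short windows
`D ≤ Δ₀` (`exists_window_count`) and the shell's defect `δs` is fixed. The classical data on the strip
`[0, (t + Δ + T)/2]` (`classical_data`), the energy level (`exists_energy_tail_le`), the bounds of the derivatives of
the time cut-off and of `f_ex'` are fixed next, and `exists_tolerances` (helper `…KineticReductionBudget`) chooses every
remaining tolerance in the order `ω → d → e → η₂ → Lv → (η₃, n) → ωx → dX → n' → lam` so that the two budgets of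
`reduction_thresholds_cold` (helper `…ReductionFrameE`) hold; the in-probability inputs are the hypotheses read with
the cut-off `g = clip((ηg2 − ·)/(ηg2 − ηg))`, and `reduction_thresholds_cold` returns `r₀` and `N₀`.

REFERENCES. J. Březina, E. Feireisl, J. Math. Soc. Japan 70 (2018) 1227–1245 (relative energy, weak–strong
uniqueness for the complete Euler system); H. Spohn, *Large Scale Dynamics of Interacting Particles* (1991), Part I
Ch. 3; N. N. Bogolyubov, Theor. Math. Phys. 24 (1975) 804–807. No named fact is invoked: everything is proved from tree
lemmas and the implication's hypotheses.
-/

noncomputable section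

namespace Summit.AtomisticToContinuum.HydrodynamicLimit.Theorems.ChaosClosesEulerKineticReduction

open scoped BigOperators Topology Classical MeasureTheory ENNReal InnerProductSpace
open Filter Set MeasureTheory
open Literature.MathematicalPhysics.KineticTheory
open Literature.Analysis.FluidPDE
open Literature.Analysis.FunctionSpaces
open Summit.AtomisticToContinuum.HydrodynamicLimit.Theses
open Summit.AtomisticToContinuum.HydrodynamicLimit.Theses.InformationPercolationEngine
open Summit.AtomisticToContinuum.HydrodynamicLimit.Theorems.LocalSecondLawNegative
open Summit.AtomisticToContinuum.HydrodynamicLimit.Theorems.LocalSecondLawLedger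
open Summit.AtomisticToContinuum.HydrodynamicLimit.Theorems.LocalSecondLawLedger.L (Mmom)
open Summit.AtomisticToContinuum.HydrodynamicLimit.Theorems.ChaosClosesEulerReduction

/-- **Registered sub-goal `stub_reductionFinalC` (helper of `stub_kineticReduction`): the threshold of the conclusion
dominates the shell's tolerance over the tiled window** — `η/2 · X < η Δ` for `X = Δ`, `η, Δ > 0`. [folklore] -/
theorem stub_reductionFinalC : ∀ {η Δ X : ℝ}, 0 < η → 0 < Δ → X = Δ → η / 2 * X < η * Δ := by
  intro η Δ X hη hΔ hX
  rw [hX]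
  nlinarith [mul_pos hη hΔ]

set_option maxHeartbeats 3200000 in
/-- **STUB `stub_kineticReduction` (line `Sketch`, crux `ChaosClosesEuler`, stmt-AtomisticToContinuum-15141): the kinetic
reduction** — inputs + the deterministic BF18 shell ⇒ `MollifiedCloseTimeAveraged` (see the module docstring).
[folklore] -/
theorem stub_kineticReduction :
    (∀ (σ : ℝ), 0 < σ → σ < 2⁻¹ → ∀ (N : ℕ)
        (Φ : HardSphereFlow (Torus.geometry (Fin 3)) (hsDiameter σ N) (N + 1)),
        ∀ z ∈ Φ.good, ∀ r : ℝ, 0 < r → r < 2⁻¹ →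
        ∀ φ : ℝ → T3 → ℝ, ContDiff ℝ 1 (Literature.Analysis.FunctionSpaces.Torus.stLift φ) →
        ∀ t : ℝ, 0 ≤ t →
        let bx : T3 → T3 → ℝ := fun y x => 3 / (Real.pi * r ^ 3) * max (1 - Torus.euclidDist y x / r) 0
        let ρm : Config (N + 1) (Fin 3) T3 → T3 → ℝ := fun w x₀ => ∫ q, bx q.1 x₀ ∂(empiricalMeasure w)
        let mm : Config (N + 1) (Fin 3) T3 → T3 → V3 := fun w x₀ => ∫ q, bx q.1 x₀ • q.2 ∂(empiricalMeasure w)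
        (∫ x, φ t x * ρm (Φ.flow t z) x) - ∫ x, φ 0 x * ρm (Φ.flow 0 z) x =
          ∫ s in Set.Icc 0 t, ∫ x, (deriv (fun s' => φ s' x) s * ρm (Φ.flow s z) x
            + ∑ k : Fin 3, mm (Φ.flow s z) x k * Literature.Analysis.FunctionSpaces.Torus.partialDeriv k (φ s) x)) →
    (∀ (σ : ℝ), 0 < σ → σ < 2⁻¹ → ∀ (N : ℕ)
        (Φ : HardSphereFlow (Torus.geometry (Fin 3)) (hsDiameter σ N) (N + 1)),
        ∀ z ∈ Φ.good, ∀ r : ℝ, 0 < r →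
        ∀ φ : ℝ → T3 → ℝ, Literature.Analysis.FunctionSpaces.Torus.IsSmoothSpaceTimeOn Set.univ φ →
        ∀ ψ : V3 → ℝ, ∀ t : ℝ, 0 ≤ t →
        let ε := hsDiameter σ N
        let G : Geometry (Fin 3) T3 := Torus.geometry (Fin 3)
        let γ : ℝ → Config (N + 1) (Fin 3) T3 := fun s => Φ.flow s z
        let pv : ℝ → Fin (N + 1) → Fin (N + 1) → V3 × V3 := fun s i j =>
          reflectVel (G.sepVec (γ s i).1 (γ s j).1) ((γ s i).2, (γ s j).2)
        let bx : T3 → T3 → ℝ := fun y x => 3 / (Real.pi * r ^ 3) * max (1 - Torus.euclidDist y x / r) 0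
        let Mψ : Config (N + 1) (Fin 3) T3 → T3 → ℝ := fun w x₀ => ∫ q, bx q.1 x₀ * ψ q.2 ∂(empiricalMeasure w)
        let Jψ : Config (N + 1) (Fin 3) T3 → T3 → Fin 3 → ℝ := fun w x₀ k =>
          ∫ q, bx q.1 x₀ * (q.2 k * ψ q.2) ∂(empiricalMeasure w)
        (∫ x, φ t x * Mψ (γ t) x) - ∫ x, φ 0 x * Mψ (γ 0) x =
          (∫ s in Set.Icc 0 t, ∫ x, (deriv (fun s' => φ s' x) s * Mψ (γ s) x
            + ∑ k : Fin 3, Jψ (γ s) x k * Literature.Analysis.FunctionSpaces.Torus.partialDeriv k (φ s) x))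
          + (N + 1 : ℝ)⁻¹ * ∑ᶠ (s : ℝ) (_ : s ∈ collisionTimes G ε γ ∩ Set.Ioc 0 t),
              ∑ i : Fin (N + 1), ∑ j : Fin (N + 1),
                (if i ≠ j ∧ ‖G.sepVec (γ s i).1 (γ s j).1‖ = ε then
                  (∫ x, φ s x * bx (γ s i).1 x) * (ψ (γ s i).2 - ψ (pv s i j).1) else 0)) →
    (∀ (a₀ θ₀ : T3 → ℝ) (u₀ : T3 → V3), Continuous a₀ → Continuous θ₀ → Continuous u₀ →
        (∀ x, 0 < a₀ x) → (∀ x, 0 < θ₀ x) → ∃ σ₀ : ℝ, 0 < σ₀ ∧ ∀ σ : ℝ, 0 < σ → σ < σ₀ →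
        ∀ (T : ℝ) (ρ θ : ℝ → T3 → ℝ) (u : ℝ → T3 → V3), IsHardSphereEulerSolution σ T ρ u θ → 0 < T →
        ∀ Φ : (N : ℕ) → HardSphereFlow (Torus.geometry (Fin 3)) (hsDiameter σ N) (N + 1),
        TendstoHydroFieldsAt (fun N => localGibbsLaw σ a₀ u₀ θ₀ N (Φ N)) Φ ρ u θ 0 →
        ∀ η δ : ℝ, 0 < η → 0 < δ → ∃ r₀ : ℝ, 0 < r₀ ∧ ∀ r : ℝ, 0 < r → r < r₀ → ∃ N₀ : ℕ, ∀ N : ℕ, N₀ ≤ N →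
        let bx : T3 → T3 → ℝ := fun y x => 3 / (Real.pi * r ^ 3) * max (1 - Torus.euclidDist y x / r) 0
        localGibbsLaw σ a₀ u₀ θ₀ N (Φ N)
            {z | ∃ x, η < |empiricalDensityField ((Φ N).flow 0 z) (fun y => bx y x) - ρ 0 x|} ≤ ENNReal.ofReal δ ∧
        localGibbsLaw σ a₀ u₀ θ₀ N (Φ N)
            {z | ∃ x, η < ‖empiricalMomentumField ((Φ N).flow 0 z) (fun y => bx y x) - ρ 0 x • u 0 x‖} ≤
              ENNReal.ofReal δ ∧
        localGibbsLaw σ a₀ u₀ θ₀ N (Φ N)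
            {z | ∃ x, η < |empiricalEnergyField ((Φ N).flow 0 z) (fun y => bx y x) -
              totalEnergyDensity (ρ 0 x) (u 0 x) (θ 0 x)|} ≤ ENNReal.ofReal δ) →
    (∃ η₀ : ℝ, 0 < η₀ ∧ ∀ (a₀ θ₀ : T3 → ℝ) (u₀ : T3 → V3), Continuous a₀ → Continuous θ₀ → Continuous u₀ →
        (∀ x, 0 < a₀ x) → (∀ x, 0 < θ₀ x) → ∃ σ₀ : ℝ, 0 < σ₀ ∧ ∀ σ : ℝ, 0 < σ → σ < σ₀ →
        ∀ (T : ℝ) (ρ θ : ℝ → T3 → ℝ) (u : ℝ → T3 → V3), IsHardSphereEulerSolution σ T ρ u θ →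
        ∀ Φ : (N : ℕ) → HardSphereFlow (Torus.geometry (Fin 3)) (hsDiameter σ N) (N + 1),
        TendstoHydroFieldsAt (fun N => localGibbsLaw σ a₀ u₀ θ₀ N (Φ N)) Φ ρ u θ 0 →
        ∀ t ∈ Set.Ico 0 T, ∀ a : Fin 3 → Fin 3 → ℝ × T3 → ℝ, (∀ j k, Continuous (a j k)) →
        (∀ p, ∑ j : Fin 3, a j j p = 0) →
        ∀ g : ℝ → ℝ, Continuous g → (∀ b, η₀ ≤ b → g b = 0) →
        ∀ η δ : ℝ, 0 < η → 0 < δ → ∃ r₀ : ℝ, 0 < r₀ ∧ ∀ r : ℝ, 0 < r → r < r₀ → ∃ N₀ : ℕ, ∀ N : ℕ, N₀ ≤ N →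
        let bx : T3 → T3 → ℝ := fun y x => 3 / (Real.pi * r ^ 3) * max (1 - Torus.euclidDist y x / r) 0
        let ρm : Config (N + 1) (Fin 3) T3 → T3 → ℝ := fun w x₀ => ∫ q, bx q.1 x₀ ∂(empiricalMeasure w)
        let mm : Config (N + 1) (Fin 3) T3 → T3 → V3 := fun w x₀ => ∫ q, bx q.1 x₀ • q.2 ∂(empiricalMeasure w)
        let Pm : Config (N + 1) (Fin 3) T3 → T3 → Fin 3 → Fin 3 → ℝ := fun w x₀ j k =>
          (∫ q, bx q.1 x₀ * (q.2 j * q.2 k) ∂(empiricalMeasure w)) - mm w x₀ j * mm w x₀ k / ρm w x₀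
        localGibbsLaw σ a₀ u₀ θ₀ N (Φ N)
          {z | η < |∫ s in Set.Icc 0 t, ∫ x, g (σ ^ 3 * ρm ((Φ N).flow s z) x) *
            ∑ j : Fin 3, ∑ k : Fin 3, a j k (s, x) * Pm ((Φ N).flow s z) x j k|} ≤ ENNReal.ofReal δ) →
    (∃ η₀ : ℝ, 0 < η₀ ∧ ∀ (a₀ θ₀ : T3 → ℝ) (u₀ : T3 → V3), Continuous a₀ → Continuous θ₀ → Continuous u₀ →
        (∀ x, 0 < a₀ x) → (∀ x, 0 < θ₀ x) → ∃ σ₀ : ℝ, 0 < σ₀ ∧ ∀ σ : ℝ, 0 < σ → σ < σ₀ →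
        ∀ (T : ℝ) (ρ θ : ℝ → T3 → ℝ) (u : ℝ → T3 → V3), IsHardSphereEulerSolution σ T ρ u θ →
        ∀ Φ : (N : ℕ) → HardSphereFlow (Torus.geometry (Fin 3)) (hsDiameter σ N) (N + 1),
        TendstoHydroFieldsAt (fun N => localGibbsLaw σ a₀ u₀ θ₀ N (Φ N)) Φ ρ u θ 0 →
        ∀ t ∈ Set.Ico 0 T, ∀ a : Fin 3 → Fin 3 → ℝ × T3 → ℝ, (∀ j k, Continuous (a j k)) →
        (∀ j k p, a j k p = a k j p) →
        ∀ g : ℝ → ℝ, Continuous g → (∀ b, η₀ ≤ b → g b = 0) →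
        ∀ η δ : ℝ, 0 < η → 0 < δ → ∃ r₀ : ℝ, 0 < r₀ ∧ ∀ r : ℝ, 0 < r → r < r₀ → ∃ N₀ : ℕ, ∀ N : ℕ, N₀ ≤ N →
        let ε := hsDiameter σ N
        let G : Geometry (Fin 3) T3 := Torus.geometry (Fin 3)
        let γ : Config (N + 1) (Fin 3) T3 → ℝ → Config (N + 1) (Fin 3) T3 := fun z s => (Φ N).flow s z
        let bx : T3 → T3 → ℝ := fun y x => 3 / (Real.pi * r ^ 3) * max (1 - Torus.euclidDist y x / r) 0
        let ρm : Config (N + 1) (Fin 3) T3 → T3 → ℝ := fun w x₀ => ∫ q, bx q.1 x₀ ∂(empiricalMeasure w)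
        let mm : Config (N + 1) (Fin 3) T3 → T3 → V3 := fun w x₀ => ∫ q, bx q.1 x₀ • q.2 ∂(empiricalMeasure w)
        let em : Config (N + 1) (Fin 3) T3 → T3 → ℝ := fun w x₀ =>
          ∫ q, bx q.1 x₀ * (‖q.2‖ ^ 2 / 2) ∂(empiricalMeasure w)
        let θm : Config (N + 1) (Fin 3) T3 → T3 → ℝ := fun w x₀ =>
          2 / 3 * (em w x₀ / ρm w x₀ - ‖mm w x₀‖ ^ 2 / (2 * ρm w x₀ ^ 2))
        let pv : Config (N + 1) (Fin 3) T3 → ℝ → Fin (N + 1) → Fin (N + 1) → V3 × V3 := fun z s i j =>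
          reflectVel (G.sepVec (γ z s i).1 (γ z s j).1) ((γ z s i).2, (γ z s j).2)
        let Kc : (Config (N + 1) (Fin 3) T3 → ℝ → Fin (N + 1) → Fin (N + 1) → ℝ) → Config (N + 1) (Fin 3) T3 → ℝ := fun F z =>
          ε / (N + 1 : ℝ) * ∑ᶠ (s : ℝ) (_ : s ∈ collisionTimes G ε (γ z) ∩ Set.Icc 0 t),
            ∑ i : Fin (N + 1), ∑ j : Fin (N + 1),
              (if i ≠ j ∧ ‖G.sepVec (γ z s i).1 (γ z s j).1‖ = ε then F z s i j else 0)
        let D : Config (N + 1) (Fin 3) T3 → ℝ := fun z =>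
          Kc (fun z s i j =>
              g (σ ^ 3 * ρm (γ z s) (γ z s i).1) *
                |⟪(pv z s i j).1 - (pv z s i j).2, ε⁻¹ • G.sepVec (γ z s i).1 (γ z s j).1⟫_ℝ| *
                ∑ k : Fin 3, ∑ l : Fin 3, a k l (s, (γ z s i).1) *
                  ((ε⁻¹ • G.sepVec (γ z s i).1 (γ z s j).1) k * (ε⁻¹ • G.sepVec (γ z s i).1 (γ z s j).1) l)) z
            - 2 * ∫ s in Set.Icc 0 t, ∫ x, g (σ ^ 3 * ρm (γ z s) x) *
                (hsPressure σ (ρm (γ z s) x) (θm (γ z s) x) - ρm (γ z s) x * θm (γ z s) x) *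
                ∑ k : Fin 3, a k k (s, x)
        localGibbsLaw σ a₀ u₀ θ₀ N (Φ N) {z | η < |D z|} ≤ ENNReal.ofReal δ) →
    (∀ (a₀ θ₀ : T3 → ℝ) (u₀ : T3 → V3), Continuous a₀ → Continuous θ₀ → Continuous u₀ →
        (∀ x, 0 < a₀ x) → (∀ x, 0 < θ₀ x) → ∃ σ₀ : ℝ, 0 < σ₀ ∧ ∀ σ : ℝ, 0 < σ → σ < σ₀ →
        ∀ Φ : (N : ℕ) → HardSphereFlow (Torus.geometry (Fin 3)) (hsDiameter σ N) (N + 1),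
        ∀ τ : ℝ, 0 < τ → ∀ η δ : ℝ, 0 < η → 0 < δ → ∃ L : ℝ, ∃ N₀ : ℕ, ∀ N : ℕ, N₀ ≤ N →
        let ε := hsDiameter σ N
        let G : Geometry (Fin 3) T3 := Torus.geometry (Fin 3)
        let γ : Config (N + 1) (Fin 3) T3 → ℝ → Config (N + 1) (Fin 3) T3 := fun z s => (Φ N).flow s z
        let Kc : (Config (N + 1) (Fin 3) T3 → ℝ → Fin (N + 1) → Fin (N + 1) → ℝ) → Config (N + 1) (Fin 3) T3 → ℝ := fun F z =>
          ε / (N + 1 : ℝ) * ∑ᶠ (s : ℝ) (_ : s ∈ collisionTimes G ε (γ z) ∩ Set.Icc 0 τ),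
            ∑ i : Fin (N + 1), ∑ j : Fin (N + 1),
              (if i ≠ j ∧ ‖G.sepVec (γ z s i).1 (γ z s j).1‖ = ε then F z s i j else 0)
        localGibbsLaw σ a₀ u₀ θ₀ N (Φ N)
            {z | η < Kc (fun z s i j => if L < ‖(γ z s i).2‖ ^ 2 + ‖(γ z s j).2‖ ^ 2 then
              1 + ‖(γ z s i).2‖ ^ 2 + ‖(γ z s j).2‖ ^ 2 else 0) z} ≤ ENNReal.ofReal δ) →
    CollisionRate → LimitCollisionMeasure.LocalSecondLaw → DensityCap →
    (∀ (σ : ℝ), 0 < σ → ∀ (η₁ : ℝ), 0 < η₁ → ∀ (χe f : ℝ → ℝ),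
        ContDiffOn ℝ 2 χe (Set.Ioi 0) → ContDiffOn ℝ 2 f (Set.Ioi 0) →
        (∀ a, 0 < a → χe a = 1 + a * deriv f a) → (∀ a, 0 < a → 0 < χe a + a * deriv χe a) →
        (∃ B : ℝ, ∀ a, 0 < a → |χe a| ≤ B) →
        (∀ a, 0 < a → a * σ ^ 3 ≤ η₁ → f a = hsExcessFreeEnergy (a * σ ^ 3) ∧ χe a = hsCompressibility (a * σ ^ 3)) →
        ∀ (T : ℝ) (ρ θ : ℝ → T3 → ℝ) (u : ℝ → T3 → V3), IsHardSphereEulerSolution σ T ρ u θ →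
        (∀ s ∈ Set.Ico 0 T, ∀ x, ρ s x * σ ^ 3 ≤ η₁ / 2) →
        ∀ t ∈ Set.Ioo 0 T, ∃ a b : ℝ, a < b ∧ ∀ ε : ℝ, 0 < ε → ∃ Δ₀ : ℝ, 0 < Δ₀ ∧ ∀ Δ : ℝ, 0 < Δ → Δ ≤ Δ₀ → Δ < t →
        ∃ δ : ℝ, 0 < δ ∧ ∀ V : ℝ → T3 → ℝ × V3 × ℝ, Measurable (Function.uncurry V) →
        (∃ C : ℝ, ∀ s x, |(V s x).1| ≤ C ∧ ‖(V s x).2.1‖ ≤ C ∧ |(V s x).2.2| ≤ C) →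
        (∀ s x, 0 ≤ (V s x).1) → (∀ s x, 0 ≤ (V s x).2.2) →
        (∀ s x, ‖(V s x).2.1‖ ^ 2 ≤ 2 * (V s x).1 * (V s x).2.2) →
        let θo : ℝ × V3 × ℝ → ℝ := fun U => 2 / 3 * (U.2.2 / U.1 - ‖U.2.1‖ ^ 2 / (2 * U.1 ^ 2))
        let pV : ℝ × V3 × ℝ → ℝ := fun U => U.1 * θo U * χe U.1
        let Zs : ℝ × V3 × ℝ → ℝ := fun U => if 0 < θo U then max a (min (3 / 2 * Real.log (θo U) - Real.log U.1 - f U.1) b) else a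
        let Etot : ℝ → T3 → ℝ := fun s x => totalEnergyDensity (ρ s x) (u s x) (θ s x)
        let cut : ℝ → ℝ → ℝ := fun τ₀ s => Real.smoothTransition ((τ₀ + Δ - s) / Δ)
        (∀ φ : ℝ → T3 → ℝ, ContDiff ℝ 1 (Literature.Analysis.FunctionSpaces.Torus.stLift φ) → ∀ τ ∈ Set.Icc 0 t, (∫ x, φ τ x * (V τ x).1) - ∫ x, φ 0 x * (V 0 x).1 = ∫ s in Set.Icc 0 τ, ∫ x, (deriv (fun s' => φ s' x) s * (V s x).1 + ∑ k : Fin 3, (V s x).2.1 k * Literature.Analysis.FunctionSpaces.Torus.partialDeriv k (φ s) x)) →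
        (∀ τ ∈ Set.Icc 0 t, |(∫ x, ⟪u τ x, (V τ x).2.1⟫_ℝ) - (∫ x, ⟪u 0 x, (V 0 x).2.1⟫_ℝ) - ∫ s in Set.Icc 0 τ, ∫ x, (⟪Literature.Analysis.FunctionSpaces.Torus.timeDerivWithin (Set.Ico 0 T) u s x, (V s x).2.1⟫_ℝ + ∑ i : Fin 3, ∑ j : Fin 3, Literature.Analysis.FunctionSpaces.Torus.partialDeriv j (fun y => u s y i) x * ((V s x).2.1 i * (V s x).2.1 j / (V s x).1 + if i = j then pV (V s x) else 0))| ≤ δ) →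
        (∀ τ₀ ∈ Set.Icc 0 (t - Δ), (∫ s in Set.Icc 0 t, ∫ x, ((V s x).1 * Zs (V s x) * Literature.Analysis.FunctionSpaces.Torus.timeDerivWithin (Set.Ico 0 T) (fun s' y => θ s' y * cut τ₀ s') s x + Zs (V s x) * ⟪(V s x).2.1, Literature.Analysis.FunctionSpaces.Torus.gradient (fun y => θ s y * cut τ₀ s) x⟫_ℝ)) + ∫ x, (V 0 x).1 * Zs (V 0 x) * (θ 0 x * cut τ₀ 0) ≤ δ) →
        (∀ τ ∈ Set.Icc 0 t, ∫ x, (V τ x).2.2 ≤ (∫ x, (V 0 x).2.2) + δ) →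
        (∀ x, |(V 0 x).1 - ρ 0 x| ≤ δ ∧ ‖(V 0 x).2.1 - ρ 0 x • u 0 x‖ ≤ δ ∧ |(V 0 x).2.2 - Etot 0 x| ≤ δ) →
        ∀ τ₀ ∈ Set.Icc 0 (t - Δ), ∫ s in Set.Icc τ₀ (τ₀ + Δ), ∫ x, (|(V s x).1 - ρ s x| + ‖(V s x).2.1 - ρ s x • u s x‖ + |(V s x).2.2 - Etot s x|) ≤ ε * Δ) →
    ∃ η₀ : ℝ, 0 < η₀ ∧ ∀ (a₀ θ₀ : T3 → ℝ) (u₀ : T3 → V3), Continuous a₀ → Continuous θ₀ → Continuous u₀ →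
      (∀ x, 0 < a₀ x) → (∀ x, 0 < θ₀ x) → ∃ σ₀ : ℝ, 0 < σ₀ ∧ ∀ σ : ℝ, 0 < σ → σ < σ₀ →
      ∀ (T : ℝ) (ρ θ : ℝ → T3 → ℝ) (u : ℝ → T3 → V3), IsHardSphereEulerSolution σ T ρ u θ →
      (∀ t ∈ Set.Ico 0 T, ∀ x, ρ t x * σ ^ 3 < η₀) →
      ∀ Φ : (N : ℕ) → HardSphereFlow (Torus.geometry (Fin 3)) (hsDiameter σ N) (N + 1),
      TendstoHydroFieldsAt (fun N => localGibbsLaw σ a₀ u₀ θ₀ N (Φ N)) Φ ρ u θ 0 →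
      ∀ t ∈ Set.Ico 0 T, ∀ Δ : ℝ, 0 < Δ → t + Δ < T → ∀ η δ : ℝ, 0 < η → 0 < δ →
      ∃ r₀ : ℝ, 0 < r₀ ∧ ∀ r : ℝ, 0 < r → r < r₀ → ∃ N₀ : ℕ, ∀ N : ℕ, N₀ ≤ N →
      let bx : T3 → T3 → ℝ := fun y x => 3 / (Real.pi * r ^ 3) * max (1 - Torus.euclidDist y x / r) 0
      localGibbsLaw σ a₀ u₀ θ₀ N (Φ N)
          {z | η * Δ < ∫ s in Set.Icc t (t + Δ),
            ((∫ x, |empiricalDensityField ((Φ N).flow s z) (fun y => bx y x) - ρ s x|)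
            + (∫ x, ‖empiricalMomentumField ((Φ N).flow s z) (fun y => bx y x) - ρ s x • u s x‖)
            + ∫ x, |empiricalEnergyField ((Φ N).flow s z) (fun y => bx y x) -
                totalEnergyDensity (ρ s x) (u s x) (θ s x)|)} ≤ ENNReal.ofReal δ := by
  intro _hMB _hWE hIL hWSI hCPV hCMUI hCR hLSL hDC hSHELL
  -- ### the band edges of the inputs, the extended law, the levels
  obtain ⟨η₀W, hη₀W, HW0⟩ := hWSI
  obtain ⟨η₀P, hη₀P, HP0⟩ := hCPV
  obtain ⟨η₀C, hη₀C, HC0⟩ := hCR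
  obtain ⟨η₀L, hη₀L, HL0⟩ := hLSL
  obtain ⟨η₀E, hη₀E, F, hFan, hFeq, -, -, -⟩ := InformationPercolationEngine.HsEosLowDensity_holds
  obtain ⟨η₁, hη₁, hη₁le, HEOS⟩ := exists_hsEos_band_extension_uniform_le
    InformationPercolationEngine.HsEosLowDensity_holds (c := min η₀L (η₀E / 2)) (by positivity)
  have hη₁L : η₁ ≤ η₀L := hη₁le.trans (min_le_left _ _)
  have hη₁E : η₁ ≤ η₀E / 2 := hη₁le.trans (min_le_right _ _)
  obtain ⟨ηg2, ηg, η₀, ηcap, hη₀, hηcap, hg12, hη₀gg, hcapg, hη₁cap, hη₀1, hg2C, hg2W, hg2P, hg2E⟩ :=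
    exists_levels hη₀C hη₀W hη₀P (half_pos hη₀E) hη₁
  have hg0 : ∀ c : ℝ, ηg2 ≤ c → ∀ b : ℝ, c ≤ b → (fun a : ℝ => max 0 (min 1 ((ηg2 - a) / (ηg2 - ηg)))) b = 0 :=
    fun c hc b hb => ChaosClosesEulerReadout.cut_eq_zero hg12 (hc.trans hb)
  have hgc := ChaosClosesEulerReadout.continuous_cut ηg ηg2
  refine ⟨η₀, hη₀, fun a₀ θ₀ u₀ ha hθ hu ha0 hθ0 => ?_⟩
  -- ### the thresholds in `σ` of the inputs
  obtain ⟨σI, hσI, HI0⟩ := hIL a₀ θ₀ u₀ ha hθ hu ha0 hθ0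
  obtain ⟨σW, hσW, HW0⟩ := HW0 a₀ θ₀ u₀ ha hθ hu ha0 hθ0
  obtain ⟨σP, hσP, HP0⟩ := HP0 a₀ θ₀ u₀ ha hθ hu ha0 hθ0
  obtain ⟨σU, hσU, HU0⟩ := hCMUI a₀ θ₀ u₀ ha hθ hu ha0 hθ0
  obtain ⟨σC, hσC, HC0⟩ := HC0 a₀ θ₀ u₀ ha hθ hu ha0 hθ0
  obtain ⟨σL, hσL, HL0⟩ := HL0 η₁ hη₁ hη₁L a₀ θ₀ u₀ ha hθ hu ha0 hθ0
  obtain ⟨σD, hσD, HD0⟩ := hDC a₀ θ₀ u₀ ha hθ hu ha0 hθ0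
  obtain ⟨σ₀, hσ₀, hsI, hsW, hsP, hsU, hsC, hsL, hsD, hs2⟩ :=
    stub_reductionFinalB hσI hσW hσP hσU hσC hσL hσD (by norm_num : (0 : ℝ) < 2⁻¹)
  refine ⟨σ₀, hσ₀, fun σ hσ hσlt T ρ θ u hE hguard Φ htie t ht Δ hΔ hΔT η δ hη hδ => ?_⟩
  have hσ2 : σ < 2⁻¹ := hσlt.trans_le hs2
  have hσ2' : σ ≤ 1 / 2 := by rw [one_div]; exact hσ2.le
  have hT0 : 0 < T := by linarith [ht.1]
  have HIσ := HI0 σ hσ (hσlt.trans_le hsI) T ρ θ u hE hT0 Φ htie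
  have HWσ := HW0 σ hσ (hσlt.trans_le hsW) T ρ θ u hE Φ htie
  have HPσ := HP0 σ hσ (hσlt.trans_le hsP) T ρ θ u hE Φ htie
  have HUσ := HU0 σ hσ (hσlt.trans_le hsU) Φ
  have HCσ := HC0 σ hσ (hσlt.trans_le hsC) Φ
  have HLσ := HL0 σ hσ (hσlt.trans_le hsL) Φ
  have HDσ := HD0 σ hσ (hσlt.trans_le hsD) T ρ θ u hE Φ htie
  -- ### the extended law at this `σ`, the shell, the tiling of the window
  obtain ⟨χe, f, hχ2, hf2, hvir, hstab, ⟨B, hB⟩, hbandp⟩ := HEOS σ hσ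
  have hB0 : 0 ≤ B := (abs_nonneg _).trans (hB 1 one_pos)
  have hbandg : ∀ s ∈ Set.Ico 0 T, ∀ x, ρ s x * σ ^ 3 ≤ η₁ / 2 := fun s hs x => (hguard s hs x).le.trans hη₀1
  obtain ⟨a₁, b₁, hab, HS1⟩ := hSHELL σ hσ η₁ hη₁ χe f hχ2 hf2 hvir hstab ⟨B, hB⟩ hbandp T ρ θ u hE hbandg (t + Δ)
    ⟨by linarith [ht.1], hΔT⟩
  obtain ⟨Δ₀, hΔ₀, HS2⟩ := HS1 (η / 2) (by positivity)
  obtain ⟨m, -, hmΔ₀, hmlt⟩ := exists_window_count (Δ' := Δ) hΔ₀ hΔ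
  obtain ⟨D, hDdef⟩ : ∃ D : ℝ, D = Δ / (m + 1 : ℝ) := ⟨_, rfl⟩
  have hD : 0 < D := by rw [hDdef]; positivity
  have heq : t + Δ = t + ((m + 1 : ℕ) : ℝ) * D := by rw [hDdef]; push_cast; field_simp
  have hmD : ((m + 1 : ℕ) : ℝ) * D = Δ := by linarith [heq]
  have hDΔ : D < Δ := by rw [hDdef]; exact hmlt
  obtain ⟨δs, hδs, HS3⟩ := HS2 D hD (by rw [hDdef]; exact hmΔ₀) (by linarith [ht.1])
  rw [heq] at HS3
  -- ### the classical data, the energy level, the tolerances in order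
  have hHT : t + ((m + 1 : ℕ) : ℝ) * D < T := heq ▸ hΔT
  have hH0 : 0 ≤ t + ((m + 1 : ℕ) : ℝ) * D := by linarith [ht.1]
  have hDH : D ≤ t + ((m + 1 : ℕ) : ℝ) * D := by linarith [ht.1]
  obtain ⟨C, hC0, hC1, hC2⟩ := exists_bound_deriv_smoothTransition
  obtain ⟨CY, hCY0, hCY⟩ := ChaosClosesEulerReadout.stub_readoutEvents hη₀E hFan hFeq
  obtain ⟨Cu, Cθ, hCu1, hCθ0, hut, hDu, hθb, hθt, hθx, Hmod⟩ := classical_data hE.smooth_velocity hE.smooth_temperature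
    (b₀ := (t + ((m + 1 : ℕ) : ℝ) * D + T) / 2) (by linarith)
  have hδ₁ : 0 < δ / 11 := by positivity
  obtain ⟨KE, hKE0, HKE⟩ := KineticClosureBridge.exists_energy_tail_le (u₀ := u₀) ha hθ hu ha0 hθ0 hσ2' hδ₁
  obtain ⟨ω, d, e, η₂, Lv, η₃, ωx, dX, lam, ηW, ηP, ηL, B3, ε₁, n, n', hω, hPd, hd, he, hed, her, hη₂, hLv, hη₃, hωx, hdX,
      hPdX, hlam, hlam1, hηW, hηP, hηL, hε₁, hB3, hn, hne, hn', hS2, hS3⟩ :=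
    exists_tolerances (H := t + ((m + 1 : ℕ) : ℝ) * D) (M := max |a₁| |b₁|) (room := (T - (t + ((m + 1 : ℕ) : ℝ) * D)) / 4)
      hδs hH0 hD hDH (by positivity) hC0 hCθ0 hCu1 hKE0 hB0 hσ hCY0 hη₀.le hηcap.le (by linarith) Hmod Hmod
      (fun e he η₂ hη₂ => HUσ (t + ((m + 1 : ℕ) : ℝ) * D + e) (by positivity) η₂ (δ / 11) hη₂ hδ₁)
  have hHe : t + ((m + 1 : ℕ) : ℝ) * D + e ≤ (t + ((m + 1 : ℕ) : ℝ) * D + T) / 2 := by linarith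
  have hT' : t + ((m + 1 : ℕ) : ℝ) * D + e < T := by linarith
  have hHpos : 0 < t + ((m + 1 : ℕ) : ℝ) * D + e := by positivity
  have hHmem : t + ((m + 1 : ℕ) : ℝ) * D + e ∈ Set.Ico 0 T := ⟨hHpos.le, hT'⟩
  obtain ⟨hωu, hωt, hωD, hωθ, hωθt, hωθx⟩ := shift_moduli hPd hd he hed hHe
  obtain ⟨N₀U, HU1⟩ := hLv
  have hthr : η / 2 * (((m + 1 : ℕ) : ℝ) * D) < η * Δ := stub_reductionFinalC hη hΔ hmD
  -- ### the thresholds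
  obtain ⟨r₀, hr₀, HR⟩ := reduction_thresholds_cold hσ hσ2 Φ hE ht.1 hD he hT' hχ2.continuousOn hf2.continuousOn hB0 hB
    (fun a ha hb => (hbandp a ha hb).2) (fun a ha hb => (hbandp a ha hb).1) (continuousOn_cutEos hη₀E hFan hFeq hη₁ hη₁E)
    HS3 hη₀.le hguard hηcap.le hη₁cap hg12 hη₀gg hcapg hKE0 hδ₁ (fun N => HKE N (Φ N) 0)
    (Lv := Lv) (η₂ := η₂) (N₀U := N₀U) HU1 hCY0 (fun a ha => hCY a ⟨ha.1, ha.2.trans hg2E⟩) hn hne hη₃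
    (fun χ hχ η' δ' hη' hδ' => HCσ _ hHpos χ hχ _ hgc (hg0 η₀C hg2C) η' δ' hη' hδ')
    (zero_le_one.trans hCu1) (fun s hs x => hut s ⟨hs.1, hs.2.trans hHe⟩ x) (fun s hs x => hDu s ⟨hs.1, hs.2.trans hHe⟩ x)
    hω.le hωu hωt hωD hωx.le hdX (space_modulus hPdX hdX he.le hHe) hηW hηP
    (fun t' ht' a hac htr η' δ' hη' hδ' => by
      simp only [Mmom_eq_integral, rhoC_eq_integral, momC_eq_integral]
      exact HWσ t' ht' a hac htr _ hgc (hg0 η₀W hg2W) η' δ' hη' hδ')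
    (fun t' ht' a hac hsym η' δ' hη' hδ' => HPσ t' ht' a hac hsym _ hgc (hg0 η₀P hg2P) η' δ' hη' hδ')
    hE.smooth_temperature hCθ0 (fun s hs x => hθb s ⟨hs.1, hs.2.trans hHe⟩ x)
    (fun s hs x => hθt s ⟨hs.1, hs.2.trans hHe⟩ x) (fun s hs x => hθx s ⟨hs.1, hs.2.trans hHe⟩ x)
    hωθ hωθt hωθx hC1 hC2 hn' hηL
    (fun φ hφ hφ0 hφv η' δ' hη' hδ' => HLσ _ hHpos a₁ b₁ hab φ hφ hφ0 hφv η' δ' hη' hδ')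
    (fun η' δ' hη' hδ' => HDσ _ hHmem η' δ' hη' hδ') (fun η' δ' hη' hδ' => HIσ η' δ' hη' hδ')
    hlam hlam1 hδs hηcap hε₁ hB3 hS2 hS3 (by linarith : 11 * (δ / 11) ≤ δ) hthr
  refine ⟨r₀, hr₀, fun r hr hrr => ?_⟩
  obtain ⟨N₀, HN⟩ := HR r hr hrr
  refine ⟨N₀, fun N hN => ?_⟩
  have h := HN N hN
  rw [← heq] at h
  exact h

end Summit.AtomisticToContinuum.HydrodynamicLimit.Theorems.ChaosClosesEulerKineticReduction

end
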